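import Literature.NumberTheory.Transcendental.ChudnovskyAnalytic
import HarnessLib

/-!
# Jets of the Weierstrass sigma function: `σ, σ′, σ″, σ‴`

Topic: `Literature/NumberTheory/Transcendental`. First brick (W2a in the plan of the unit
`provefact-Literature.NumberTheory.Transcendental.H-b596640137`) of the **theta model** of the
universal vectorial extension `E♮` and of the group varieties `M_κ = 𝔾ₘ^β × P_κ` of
`SemistableQuotients.lean`, on which the remaining transcendence input of
`Literature.NumberTheory.Transcendental.HuberWustholzOnePeriods` (Baker–Wüstholz's Semistability
Theorem: Baker's method with multiplicity estimates) has to be carried out. The projective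
coordinates of `exp_{E♮}(z, t) = (℘(z), ℘′(z), t - ζ(z))`, extended over the lattice, are the
entire functions `σ³, σ³℘, σ³℘′, σ³(t - ζ), σ³℘(t - ζ), σ³(℘′(t - ζ) + 2℘²)`, and each of them is
a polynomial in `t, σ, σ′, σ″, σ‴` (sequel `UnivExtTheta.lean`). This file provides the four
**sigma jets** `σ⁽ⁿ⁾ = PeriodPair.sigmaDeriv L n`, `n ≤ 3`, with exactly the properties that
model needs, all PROVED:

* `PeriodPair.differentiable_sigmaDeriv` — the jets are entire;
* `PeriodPair.sigmaDeriv_one_eq`, `sigmaDeriv_two_eq`, `sigmaDeriv_three_eq` — off the lattice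
  `σ′ = σζ`, `σ″ = σ(ζ² - ℘)`, `σ‴ = σ(ζ³ - 3ζ℘ - ℘′)` (from `σ′/σ = ζ`, `ζ′ = -℘`, `℘′ = d℘/dz`);
* `PeriodPair.sigmaDeriv_one_zero`, `sigmaDeriv_two_zero` — `σ′(0) = 1`, `σ″(0) = 0`
  (`σ(z) = z ∏(…)`, and `σ` is odd);
* `PeriodPair.sigmaDeriv_add_period` — the jets under `z ↦ z + ωᵢ` (`ωᵢ = L.basis i`,
  `ηᵢ = L.quasiPeriod i`, the tree's two `Fin 2`-families): with the automorphy factor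
  `χᵢ(z) = -e^{ηᵢωᵢ/2} e^{ηᵢ z}` of `σ(z + ωᵢ) = χᵢ(z)σ(z)` (`PeriodPair.sigmaAut`) one has
  `σ′(z + ωᵢ) = χᵢ(ηᵢσ + σ′)`, `σ″(z + ωᵢ) = χᵢ(ηᵢ²σ + 2ηᵢσ′ + σ″)`,
  `σ‴(z + ωᵢ) = χᵢ(ηᵢ³σ + 3ηᵢ²σ′ + 3ηᵢσ″ + σ‴)`;
* `PeriodPair.exists_norm_sigmaDeriv_le_exp` — order-two growth `‖σ⁽ⁿ⁾(z)‖ ≤ e^{C(1 + |z|²)}`,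
  `n ≤ 3`, with one constant (Cauchy's estimate on the growth of `σ`).

Sources: Whittaker–Watson, *A Course of Modern Analysis*, §20.42 (`σ` entire, `σ′/σ = ζ`),
§20.421 (quasi-periodicity of `σ`), §20.4 (`ζ′ = -℘`); the jet formulas are their formal
derivatives. The analytic inputs are the discharged facts of `EllipticCurves/WeierstrassSigma*.lean`,
`WeierstrassZeta*.lean`, `RealLatticePeriodProofs.lean` (`hasDerivAt_weierstrassP`) and
`Transcendental/ChudnovskyAnalytic.lean` (growth of `σ, σ′, σ″`). The `PeriodPair.*` declarations
are deliberate dot-notation extensions of Mathlib's `PeriodPair`, declared with absolute names.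
`σ′(0) = 1` is also `PeriodPair.hasDerivAt_weierstrassSigma_zero` of
`EllipticCurves/WeierstrassTorsion.lean` (not in this import closure; re-derived here in three
lines). The three generic one-variable lemmas `deriv_comp_neg_of_odd`, `deriv_comp_neg_of_even`,
`deriv_add_const_of_eq_exp_mul` are plain `ℂ`-calculus (candidates for `Literature/Analysis`).
-/

noncomputable section

open Complex Filter Topology
open scoped PeriodPair

namespace Literature.NumberTheory.Transcendental

variable (L : PeriodPair)

/-! ### The jets and their holomorphy -/

/-- The `n`-th derivative `σ⁽ⁿ⁾` of the Weierstrass sigma function of `L` (an entire function;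
`n = 0, 1, 2, 3` are used below). [folklore] -/
def _root_.PeriodPair.sigmaDeriv (n : ℕ) : ℂ → ℂ := iteratedDeriv n L.weierstrassSigma

/-- `σ⁽⁰⁾ = σ`. [folklore] -/
@[simp] theorem _root_.PeriodPair.sigmaDeriv_zero_eq : L.sigmaDeriv 0 = L.weierstrassSigma :=
  iteratedDeriv_zero

/-- `σ⁽ⁿ⁺¹⁾ = (σ⁽ⁿ⁾)′`. [folklore] -/
theorem _root_.PeriodPair.sigmaDeriv_succ (n : ℕ) :
    L.sigmaDeriv (n + 1) = deriv (L.sigmaDeriv n) :=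
  iteratedDeriv_succ

/-- `σ⁽¹⁾ = σ′`. [folklore] -/
theorem _root_.PeriodPair.sigmaDeriv_one : L.sigmaDeriv 1 = deriv L.weierstrassSigma :=
  iteratedDeriv_one

/-- The jets `σ⁽ⁿ⁾` are entire (Whittaker–Watson §20.42: `σ` is an integral function).
[cite: WhittakerWatson1927, §20.42] -/
theorem _root_.PeriodPair.differentiable_sigmaDeriv (n : ℕ) : Differentiable ℂ (L.sigmaDeriv n) := by
  induction n with
  | zero =>
    rw [PeriodPair.sigmaDeriv_zero_eq]
    exact L.differentiable_weierstrassSigma_holds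
  | succ n ih =>
    rw [PeriodPair.sigmaDeriv_succ]
    exact ih.deriv

/-- Pointwise differentiability of the jets: `σ⁽ⁿ⁾` has derivative `σ⁽ⁿ⁺¹⁾(z)` at `z`. [folklore] -/
theorem _root_.PeriodPair.hasDerivAt_sigmaDeriv (n : ℕ) (z : ℂ) :
    HasDerivAt (L.sigmaDeriv n) (L.sigmaDeriv (n + 1) z) z := by
  rw [PeriodPair.sigmaDeriv_succ]
  exact ((L.differentiable_sigmaDeriv n) z).hasDerivAt

/-! ### The jets off the lattice: `σ′ = σζ`, `σ″ = σ(ζ² - ℘)`, `σ‴ = σ(ζ³ - 3ζ℘ - ℘′)` -/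

variable {L}

/-- `ζ` has derivative `-℘` at points off the lattice. [cite: WhittakerWatson1927, §20.4] -/
theorem _root_.PeriodPair.hasDerivAt_weierstrassZeta {z : ℂ} (hz : z ∉ L.lattice) :
    HasDerivAt L.weierstrassZeta (-℘[L] z) z := by
  have hd : DifferentiableAt ℂ L.weierstrassZeta z :=
    L.differentiableOn_weierstrassZeta_holds.differentiableAt
      (L.isClosed_lattice.isOpen_compl.mem_nhds hz)
  rw [← L.deriv_weierstrassZeta_holds z hz]
  exact hd.hasDerivAt

variable (L) in
/-- **`σ′ = σ ζ` off the lattice** (Whittaker–Watson §20.42, `(d/dz) log σ = ζ`).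
[cite: WhittakerWatson1927, §20.42] -/
theorem _root_.PeriodPair.sigmaDeriv_one_eq {z : ℂ} (hz : z ∉ L.lattice) :
    L.sigmaDeriv 1 z = L.weierstrassSigma z * L.weierstrassZeta z := by
  rw [PeriodPair.sigmaDeriv_one, Chudnovsky.deriv_weierstrassSigma L hz, mul_comm]

/-- `σ′ = σζ` as an identity of functions near every point off the lattice. [folklore] -/
theorem _root_.PeriodPair.sigmaDeriv_one_eventuallyEq {z : ℂ} (hz : z ∉ L.lattice) :
    L.sigmaDeriv 1 =ᶠ[𝓝 z] fun w => L.weierstrassSigma w * L.weierstrassZeta w := by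
  filter_upwards [L.isClosed_lattice.isOpen_compl.mem_nhds hz] with w hw
  exact L.sigmaDeriv_one_eq hw

variable (L) in
/-- **`σ″ = σ(ζ² - ℘)` off the lattice** (differentiate `σ′ = σζ` using `ζ′ = -℘`). [folklore] -/
theorem _root_.PeriodPair.sigmaDeriv_two_eq {z : ℂ} (hz : z ∉ L.lattice) :
    L.sigmaDeriv 2 z =
      L.weierstrassSigma z * (L.weierstrassZeta z ^ 2 - ℘[L] z) := by
  have h1 : HasDerivAt (fun w => L.weierstrassSigma w * L.weierstrassZeta w)
      (L.sigmaDeriv 1 z * L.weierstrassZeta z + L.weierstrassSigma z * (-℘[L] z)) z := by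
    have hσ : HasDerivAt L.weierstrassSigma (L.sigmaDeriv 1 z) z := by
      simpa using L.hasDerivAt_sigmaDeriv 0 z
    exact hσ.mul (PeriodPair.hasDerivAt_weierstrassZeta hz)
  rw [show (2 : ℕ) = 1 + 1 from rfl, PeriodPair.sigmaDeriv_succ,
    (PeriodPair.sigmaDeriv_one_eventuallyEq hz).deriv_eq, h1.deriv, L.sigmaDeriv_one_eq hz]
  ring

/-- `σ″ = σ(ζ² - ℘)` near every point off the lattice. [folklore] -/
theorem _root_.PeriodPair.sigmaDeriv_two_eventuallyEq {z : ℂ} (hz : z ∉ L.lattice) :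
    L.sigmaDeriv 2 =ᶠ[𝓝 z]
      fun w => L.weierstrassSigma w * (L.weierstrassZeta w ^ 2 - ℘[L] w) := by
  filter_upwards [L.isClosed_lattice.isOpen_compl.mem_nhds hz] with w hw
  exact L.sigmaDeriv_two_eq hw

variable (L) in
/-- **`σ‴ = σ(ζ³ - 3ζ℘ - ℘′)` off the lattice** (differentiate once more, `℘` having derivative
`℘′`). [folklore] -/
theorem _root_.PeriodPair.sigmaDeriv_three_eq {z : ℂ} (hz : z ∉ L.lattice) :
    L.sigmaDeriv 3 z =
      L.weierstrassSigma z *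
        (L.weierstrassZeta z ^ 3 - 3 * L.weierstrassZeta z * ℘[L] z - ℘'[L] z) := by
  have h1 : HasDerivAt (fun w => L.weierstrassSigma w * (L.weierstrassZeta w ^ 2 - ℘[L] w))
      (L.sigmaDeriv 1 z * (L.weierstrassZeta z ^ 2 - ℘[L] z) +
        L.weierstrassSigma z *
          ((2 : ℕ) * L.weierstrassZeta z ^ (2 - 1) * (-℘[L] z) - ℘'[L] z)) z := by
    have hσ : HasDerivAt L.weierstrassSigma (L.sigmaDeriv 1 z) z := by
      simpa using L.hasDerivAt_sigmaDeriv 0 z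
    exact hσ.mul (((PeriodPair.hasDerivAt_weierstrassZeta hz).pow 2).sub
      (PeriodPair.hasDerivAt_weierstrassP hz))
  rw [show (3 : ℕ) = 2 + 1 from rfl, PeriodPair.sigmaDeriv_succ,
    (PeriodPair.sigmaDeriv_two_eventuallyEq hz).deriv_eq, h1.deriv, L.sigmaDeriv_one_eq hz]
  push_cast
  ring

/-! ### Values at the origin: `σ(0) = 0`, `σ′(0) = 1`, `σ″(0) = 0` -/

variable (L)

/-- `σ(0) = 0`. [folklore] -/
theorem _root_.PeriodPair.sigmaDeriv_zero_zero : L.sigmaDeriv 0 0 = 0 := by simp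

/-- **`σ′(0) = 1`**: `σ(z) = z · Π(z)` with `Π(0) = ∏ (1 - 0)·e⁰ = 1`
(Whittaker–Watson §20.42). [cite: WhittakerWatson1927, §20.42] -/
theorem _root_.PeriodPair.sigmaDeriv_one_zero : L.sigmaDeriv 1 0 = 1 := by
  have hP : HasDerivAt (fun z : ℂ => ∏' l : L.lattice, PeriodPair.sigmaFactor z l)
      (deriv (fun z : ℂ => ∏' l : L.lattice, PeriodPair.sigmaFactor z l) 0) 0 :=
    (L.differentiable_tprod_sigmaFactor 0).hasDerivAt
  have h : HasDerivAt L.weierstrassSigma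
      (1 * (∏' l : L.lattice, PeriodPair.sigmaFactor (0 : ℂ) l) +
        0 * deriv (fun z : ℂ => ∏' l : L.lattice, PeriodPair.sigmaFactor z l) 0) 0 :=
    (hasDerivAt_id (0 : ℂ)).mul hP
  rw [PeriodPair.sigmaDeriv_one, h.deriv]
  simp [PeriodPair.sigmaFactor]

/-- The derivative of an odd function is even. [folklore] -/
theorem deriv_comp_neg_of_odd {f : ℂ → ℂ} (hodd : ∀ z, f (-z) = -f z) (z : ℂ) :
    deriv f (-z) = deriv f z := by
  have h1 : deriv (fun w => f (-w)) z = -deriv f (-z) := deriv_comp_neg f z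
  have h2 : (fun w => f (-w)) = fun w => -f w := funext hodd
  rw [h2, deriv.fun_neg] at h1
  linear_combination h1

/-- The derivative of an even function is odd. [folklore] -/
theorem deriv_comp_neg_of_even {f : ℂ → ℂ} (heven : ∀ z, f (-z) = f z) (z : ℂ) :
    deriv f (-z) = -deriv f z := by
  have h1 : deriv (fun w => f (-w)) z = -deriv f (-z) := deriv_comp_neg f z
  have h2 : (fun w => f (-w)) = f := funext heven
  rw [h2] at h1
  linear_combination h1

/-- `σ′` is even (`σ` is odd). [folklore] -/
theorem _root_.PeriodPair.sigmaDeriv_one_neg (z : ℂ) : L.sigmaDeriv 1 (-z) = L.sigmaDeriv 1 z := by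
  rw [PeriodPair.sigmaDeriv_one]
  exact deriv_comp_neg_of_odd L.weierstrassSigma_neg z

/-- `σ″` is odd. [folklore] -/
theorem _root_.PeriodPair.sigmaDeriv_two_neg (z : ℂ) :
    L.sigmaDeriv 2 (-z) = -L.sigmaDeriv 2 z := by
  rw [show (2 : ℕ) = 1 + 1 from rfl, PeriodPair.sigmaDeriv_succ]
  exact deriv_comp_neg_of_even L.sigmaDeriv_one_neg z

/-- **`σ″(0) = 0`** (`σ″` is odd). [folklore] -/
theorem _root_.PeriodPair.sigmaDeriv_two_zero : L.sigmaDeriv 2 0 = 0 := by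
  have h := L.sigmaDeriv_two_neg 0
  rw [neg_zero] at h
  linear_combination h / 2

/-! ### The jets under translation by a period -/

/-- Differentiating an automorphy relation: if `f(z + ω) = c e^{ηz} g(z)` for all `z`, with `g`
differentiable, then `f′(z + ω) = c e^{ηz} (η g(z) + g′(z))`. [folklore] -/
theorem deriv_add_const_of_eq_exp_mul {f g : ℂ → ℂ} (hg : Differentiable ℂ g) {c η ω : ℂ}
    (h : ∀ z, f (z + ω) = c * cexp (η * z) * g z) (z : ℂ) :
    deriv f (z + ω) = c * cexp (η * z) * (η * g z + deriv g z) := by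
  have h1 : deriv (fun w => f (w + ω)) z = deriv f (z + ω) := deriv_comp_add_const f ω z
  have h2 : (fun w => f (w + ω)) = fun w => c * cexp (η * w) * g w := funext h
  have h3 : HasDerivAt (fun w => c * cexp (η * w) * g w)
      (c * (cexp (η * z) * (η * 1)) * g z + c * cexp (η * z) * deriv g z) z := by
    have he : HasDerivAt (fun w => c * cexp (η * w)) (c * (cexp (η * z) * (η * 1))) z :=
      (((hasDerivAt_id z).const_mul η).cexp).const_mul c
    exact he.mul (hg z).hasDerivAt
  rw [← h1, h2, h3.deriv]
  ring

/-- The **automorphy factor** `χᵢ(z) = -e^{ηᵢωᵢ/2} · e^{ηᵢ z}` (`= -e^{ηᵢ(z + ωᵢ/2)}`) of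
`σ(z + ωᵢ) = χᵢ(z) σ(z)`, for the basic periods `ωᵢ = L.basis i` (Mathlib) and quasi-periods
`ηᵢ = L.quasiPeriod i` (`WeierstrassZeta.lean`) (Whittaker–Watson §20.421).
[cite: WhittakerWatson1927, §20.421] -/
def _root_.PeriodPair.sigmaAut (i : Fin 2) (z : ℂ) : ℂ :=
  -cexp (L.quasiPeriod i * L.basis i / 2) * cexp (L.quasiPeriod i * z)

/-- The automorphy factor never vanishes. [folklore] -/
theorem _root_.PeriodPair.sigmaAut_ne_zero (i : Fin 2) (z : ℂ) : L.sigmaAut i z ≠ 0 :=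
  mul_ne_zero (neg_ne_zero.mpr (Complex.exp_ne_zero _)) (Complex.exp_ne_zero _)

/-- `σ(z + ωᵢ) = χᵢ(z) σ(z)` for `i = 1, 2` (Whittaker–Watson §20.421, the printed
`σ(z + ωᵢ) = -e^{ηᵢ(z + ωᵢ/2)} σ(z)` with the exponential split).
[cite: WhittakerWatson1927, §20.421] -/
theorem _root_.PeriodPair.weierstrassSigma_add_period (i : Fin 2) (z : ℂ) :
    L.weierstrassSigma (z + L.basis i) = L.sigmaAut i z * L.weierstrassSigma z := by
  have key : ∀ ω η : ℂ, -cexp (η * (z + ω / 2)) = (-cexp (η * ω / 2)) * cexp (η * z) := by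
    intro ω η
    rw [neg_mul, ← Complex.exp_add]
    congr 2
    ring
  fin_cases i
  · simpa [PeriodPair.sigmaAut, key] using L.weierstrassSigma_add_ω₁_holds z
  · simpa [PeriodPair.sigmaAut, key] using L.weierstrassSigma_add_ω₂_holds z

/-- **The sigma jets under `z ↦ z + ωᵢ`.** With `ω = ωᵢ`, `η = ηᵢ` and `χ = χᵢ(z)`
(`PeriodPair.sigmaAut`, so that `σ(z + ω) = χ σ(z)`):
`σ′(z + ω) = χ(ησ + σ′)`, `σ″(z + ω) = χ(η²σ + 2ησ′ + σ″)`,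
`σ‴(z + ω) = χ(η³σ + 3η²σ′ + 3ησ″ + σ‴)` (all at `z`) — the formal derivatives of the
quasi-periodicity of `σ` (Whittaker–Watson §20.421). [cite: WhittakerWatson1927, §20.421] -/
theorem _root_.PeriodPair.sigmaDeriv_add_period (i : Fin 2) (z : ℂ) :
    L.sigmaDeriv 0 (z + L.basis i) = L.sigmaAut i z * L.sigmaDeriv 0 z ∧
    L.sigmaDeriv 1 (z + L.basis i) =
      L.sigmaAut i z * (L.quasiPeriod i * L.sigmaDeriv 0 z + L.sigmaDeriv 1 z) ∧
    L.sigmaDeriv 2 (z + L.basis i) = L.sigmaAut i z *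
      (L.quasiPeriod i ^ 2 * L.sigmaDeriv 0 z +
        2 * L.quasiPeriod i * L.sigmaDeriv 1 z + L.sigmaDeriv 2 z) ∧
    L.sigmaDeriv 3 (z + L.basis i) = L.sigmaAut i z *
      (L.quasiPeriod i ^ 3 * L.sigmaDeriv 0 z +
        3 * L.quasiPeriod i ^ 2 * L.sigmaDeriv 1 z +
        3 * L.quasiPeriod i * L.sigmaDeriv 2 z + L.sigmaDeriv 3 z) := by
  set ω := L.basis i with hω
  set η := L.quasiPeriod i with hη
  set c := -cexp (η * ω / 2) with hc
  have haut : ∀ w, L.sigmaAut i w = c * cexp (η * w) := fun w => rfl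
  have hd := L.differentiable_sigmaDeriv
  -- order 0
  have h0 : ∀ w, L.sigmaDeriv 0 (w + ω) = c * cexp (η * w) * L.sigmaDeriv 0 w := fun w => by
    rw [PeriodPair.sigmaDeriv_zero_eq, ← haut]
    exact L.weierstrassSigma_add_period i w
  -- order 1
  have h1 : ∀ w, L.sigmaDeriv 1 (w + ω) =
      c * cexp (η * w) * (η * L.sigmaDeriv 0 w + L.sigmaDeriv 1 w) := fun w => by
    have := deriv_add_const_of_eq_exp_mul (hd 0) h0 w
    rwa [← PeriodPair.sigmaDeriv_succ] at this
  -- order 2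
  have hg1 : Differentiable ℂ fun w => η * L.sigmaDeriv 0 w + L.sigmaDeriv 1 w :=
    ((hd 0).const_mul η).add (hd 1)
  have hg1' : ∀ w, deriv (fun w => η * L.sigmaDeriv 0 w + L.sigmaDeriv 1 w) w =
      η * L.sigmaDeriv 1 w + L.sigmaDeriv 2 w := fun w => by
    have : HasDerivAt (fun w => η * L.sigmaDeriv 0 w + L.sigmaDeriv 1 w)
        (η * L.sigmaDeriv (0 + 1) w + L.sigmaDeriv (1 + 1) w) w :=
      ((L.hasDerivAt_sigmaDeriv 0 w).const_mul η).add (L.hasDerivAt_sigmaDeriv 1 w)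
    simpa using this.deriv
  have h2 : ∀ w, L.sigmaDeriv 2 (w + ω) = c * cexp (η * w) *
      (η ^ 2 * L.sigmaDeriv 0 w + 2 * η * L.sigmaDeriv 1 w + L.sigmaDeriv 2 w) := fun w => by
    have := deriv_add_const_of_eq_exp_mul hg1 h1 w
    rw [← PeriodPair.sigmaDeriv_succ, hg1'] at this
    rw [this]
    ring
  -- order 3
  have hg2 : Differentiable ℂ fun w =>
      η ^ 2 * L.sigmaDeriv 0 w + 2 * η * L.sigmaDeriv 1 w + L.sigmaDeriv 2 w :=
    ((((hd 0).const_mul (η ^ 2)).add ((hd 1).const_mul (2 * η))).add (hd 2))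
  have hg2' : ∀ w, deriv (fun w =>
      η ^ 2 * L.sigmaDeriv 0 w + 2 * η * L.sigmaDeriv 1 w + L.sigmaDeriv 2 w) w =
      η ^ 2 * L.sigmaDeriv 1 w + 2 * η * L.sigmaDeriv 2 w + L.sigmaDeriv 3 w := fun w => by
    have : HasDerivAt
        (fun w => η ^ 2 * L.sigmaDeriv 0 w + 2 * η * L.sigmaDeriv 1 w + L.sigmaDeriv 2 w)
        (η ^ 2 * L.sigmaDeriv (0 + 1) w + 2 * η * L.sigmaDeriv (1 + 1) w +
          L.sigmaDeriv (2 + 1) w) w :=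
      (((L.hasDerivAt_sigmaDeriv 0 w).const_mul (η ^ 2)).add
        ((L.hasDerivAt_sigmaDeriv 1 w).const_mul (2 * η))).add (L.hasDerivAt_sigmaDeriv 2 w)
    simpa using this.deriv
  have h3 : ∀ w, L.sigmaDeriv 3 (w + ω) = c * cexp (η * w) *
      (η ^ 3 * L.sigmaDeriv 0 w + 3 * η ^ 2 * L.sigmaDeriv 1 w + 3 * η * L.sigmaDeriv 2 w +
        L.sigmaDeriv 3 w) := fun w => by
    have := deriv_add_const_of_eq_exp_mul hg2 h2 w
    rw [← PeriodPair.sigmaDeriv_succ, hg2'] at this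
    rw [this]
    ring
  simp only [haut]
  exact ⟨h0 z, h1 z, h2 z, h3 z⟩

/-! ### Growth of order two -/

/-- **Order-two growth of the sigma jets**: one constant `C ≥ 0` with
`‖σ⁽ⁿ⁾(z)‖ ≤ e^{C(1 + |z|²)}` for `n = 0, 1, 2, 3` (Chudnovsky 1984, Ch. 7, p. 306 for `σ`;
Cauchy's estimate for the derivatives). [cite: Chudnovsky1984, Ch. 7 §2 p. 306] -/
theorem _root_.PeriodPair.exists_norm_sigmaDeriv_le_exp :
    ∃ C : ℝ, 0 ≤ C ∧ ∀ n ≤ 3, ∀ z : ℂ, ‖L.sigmaDeriv n z‖ ≤ Real.exp (C * (1 + ‖z‖ ^ 2)) := by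
  obtain ⟨C, hC0, hC⟩ := Chudnovsky.norm_weierstrassSigma_derivs_le_exp L
  have h2 : ∀ z : ℂ, ‖L.sigmaDeriv 2 z‖ ≤ Real.exp (C * (1 + ‖z‖ ^ 2)) := fun z => by
    rw [show (2 : ℕ) = 1 + 1 from rfl, PeriodPair.sigmaDeriv_succ, PeriodPair.sigmaDeriv_one]
    exact (hC z).2.2
  have h3 := Chudnovsky.norm_deriv_le_exp_of_le_exp (L.differentiable_sigmaDeriv 2) hC0 h2
  refine ⟨3 * C, by positivity, fun n hn z => ?_⟩
  have hmono : Real.exp (C * (1 + ‖z‖ ^ 2)) ≤ Real.exp (3 * C * (1 + ‖z‖ ^ 2)) :=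
    Real.exp_le_exp.mpr (by nlinarith [sq_nonneg ‖z‖])
  interval_cases n
  · rw [PeriodPair.sigmaDeriv_zero_eq]
    exact (hC z).1.trans hmono
  · rw [PeriodPair.sigmaDeriv_one]
    exact (hC z).2.1.trans hmono
  · exact (h2 z).trans hmono
  · rw [show (3 : ℕ) = 2 + 1 from rfl, PeriodPair.sigmaDeriv_succ]
    exact h3 z

end Literature.NumberTheory.Transcendental

end
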